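import Summits.CriticalPhenomena.SAWScalingLimit.Theorems.SAWDefectDecoherencePolygonParitySqueezeDefs
import Summits.CriticalPhenomena.SAWScalingLimit.Theorems.SAWDefectDecoherenceBoundaryClosureRGateProfileDensity
import Summits.CriticalPhenomena.SAWScalingLimit.Theorems.SAWDefectDecoherenceBoundaryClosureRGateProfileRatioMixing
import Summits.CriticalPhenomena.SAWScalingLimit.Theorems.SAWDefectDecoherenceBoundaryClosureRGateStabilityReflection
import Literature.NumberTheory.Transcendental.ExpDominantSolvabilityLogRatio
import Mathlib.Order.Filter.AtTopBot.CountablyGenerated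
import HarnessLib

/-!
# Crux `BoundaryClosureR` (stmt-CriticalPhenomena-14004), line `polygon-parity-squeeze`:
# the gate profile law from the identification (registered stub `gateProfile_of_identification`,
# piece F — the last step — of the (A) assembly)

THEOREM (`gateProfile_of_identification`, registered header verbatim).  For an exact-polygon
admissible pinned datum `(D, ρ, Λ, m, b; a, r₀, m₀)` with `2ρ < |pt 0 − pt 1|` and `RatioMixingAt Λ a b`,
suppose that for every conformal frame `(Φ, L, L_b)` and every mesh sequence `ns → 0⁺` there are a
subsequence `ms`, a function `g`, a positive measure `μ` and a constant `c` with: `μ` finite on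
compacts off the root; convergence of the normalised boundary arrival sums
`S_δ(w) = δ Σ_{e ∈ ∂Λ_δ} w(δ·mid e) ‖F₀ e‖/‖F₀ b_δ‖ → ∫ w dμ` along `ns ∘ ms` for real test functions
off the root; the LOCAL GATE IDENTITY `∫_Ω g ∂̄φ = −√3 i ∫ φ dμ` for smooth `φ` supported near any
gate point of `B(pt 1, ρ)`; and `g = c·exp((5/8)(L − L_b))` on `Ω`.  Then the gate profile law
`GateProfileAt D ρ (ρ/2) Λ a b` holds: for every frame, every continuous gate extension `L̄` of `L`
and every continuous `g₀` compactly supported in `B(pt 1, ρ/2)`,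
`δ Σ_{e ∈ ∂Λ_δ, δ·mid e ∈ B(pt 1, ρ/2)} g₀(δ·mid e) F₀(e)/F₀(b_δ) → ∫ g₀(x + i·im pt 1) exp((5/8)(L̄ − L_b)) dx`.

PROOF.  Subsequence principle (`Filter.tendsto_of_subseq_tendsto`, `𝓝[>] 0` is countably
generated): given `ns`, take `(ms, g, μ, c)` from the hypothesis for THE SAME frame.
(1) The gate functional is `S(re g₀) + i S(im g₀)` (`GateProfile.gateSum_eq_ofReal_add`), so it
tends to `∫ g₀ dμ` along `ns ∘ ms`.  (2) `μ` has no mass off the gate line near `pt 1`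
(`GateProfile.eventually_sideSum_eq_zero_of_im_ne`), and the local gate identity plus Green's formula
on gate half-balls give `∫ φ dμ = (c/(2√3)) ∫ φ(x + i im pt 1) exp((5/8)(L̄ − L_b)) dx` for all
continuous `φ` supported in `B(pt 1, ρ/2)` (`GateProfile.integral_eq_const_mul_lineIntegral`:
partition of unity and mollification).  (3) `RatioMixingAt` forces `c/(2√3) = 1`
(`GateProfile.const_eq_one_of_ratioMixing`, using `L̄(pt 1) = L_b`).  ∎

References: H. Duminil-Copin, S. Smirnov, Ann. of Math. 175 (2012), Conjecture 2 and §3;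
G. Lawler, O. Schramm, W. Werner (2004), §3.4.
-/

noncomputable section

open scoped BigOperators Topology ContDiff
open Filter Set Metric MeasureTheory Complex
open Literature.Probability.LatticeModels Literature.Probability.RandomPlanarGeometry
open Literature.Probability.RandomPlanarGeometry.SAW
open Literature.Analysis.Complex (dbarAlong)
open Summit.CriticalPhenomena.SAWScalingLimit.Theses.SAWDefectDecoherence
open Summit.CriticalPhenomena.SAWScalingLimit.Theorems.PickHalfPlane

namespace Summit.CriticalPhenomena.SAWScalingLimit.Theorems.PolygonParitySqueeze

/-! ### 1. The gate extension at the normaliser -/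

/-- **`L̄(pt 1) = L_b`.** A continuous extension `L̄` of `L` to `Ω ∪ gate` takes at the normaliser
the limit `L_b` of `L` within `Ω` (the normaliser lies in the closure of the flat piece). [folklore] -/
theorem GateProfile.gateExtension_apply_pt_one (D : DobrushinDomain) {ρ : ℝ} (hρ : 0 < ρ)
    (hflat : D.carrier ∩ ball (D.pt 1) ρ = {z : ℂ | (D.pt 1).im < z.im} ∩ ball (D.pt 1) ρ)
    {L Lbar : ℂ → ℂ} {Lb : ℂ} (hLbar : ContinuousOn Lbar (D.carrier ∪ gateSeg D ρ))
    (hLbarL : EqOn Lbar L D.carrier) (hLb : Tendsto L (𝓝[D.carrier] (D.pt 1)) (𝓝 Lb)) :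
    Lbar (D.pt 1) = Lb := by
  have hx : D.pt 1 ∈ gateSeg D ρ := ⟨rfl, mem_ball_self hρ⟩
  have hxcl : D.pt 1 ∈ closure D.carrier := Identification.mem_closure_of_flat hflat hx.2 rfl
  haveI : NeBot (𝓝[D.carrier] (D.pt 1)) := mem_closure_iff_nhdsWithin_neBot.1 hxcl
  have h1 : Tendsto Lbar (𝓝[D.carrier ∪ gateSeg D ρ] (D.pt 1)) (𝓝 (Lbar (D.pt 1))) :=
    hLbar _ (Or.inr hx)
  have h2 : Tendsto L (𝓝[D.carrier] (D.pt 1)) (𝓝 (Lbar (D.pt 1))) :=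
    (h1.mono_left (nhdsWithin_mono _ subset_union_left)).congr'
      (eventually_mem_nhdsWithin.mono fun z hz => hLbarL hz)
  exact tendsto_nhds_unique h2 hLb

/-! ### 2. The registered stub -/

/-- **Registered stub `gateProfile_of_identification`** (crux item stmt-CriticalPhenomena-14004, line
`polygon-parity-squeeze`, piece F of the (A) assembly): the gate profile law on the gate ball of
radius `ρ/2` from the subsequential identification data (see the module docstring for statement and
proof). [cite: DuminilCopinSmirnov2012, Conjecture 2 (boundary shadow on the gate)] -/
theorem gateProfile_of_identification : ∀ (D : DobrushinDomain) (ρ : ℝ) (Λ : ℝ → Finset HexVertex) (m : ℝ → ℤ) (b : ℝ → Sym2 HexVertex), AdmissibleFamily D ρ Λ m b → ExactPolygonFamily D Λ → ∀ (a : ℝ → Sym2 HexVertex) (r₀ : ℝ) (m₀ : ℝ → ℤ), PinnedFlatRoot D Λ b (D.pt 0) a r₀ m₀ → 2 * ρ < dist (D.pt 0) (D.pt 1) → RatioMixingAt Λ a b → (∀ (Φ : ConformalEquiv D.carrier UpperHalfPlane.upperHalfPlaneSet) (L : ℂ → ℂ) (Lb : ℂ), ConformalFrame D Φ L Lb → ∀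 (ns : ℕ → ℝ), Filter.Tendsto ns Filter.atTop (𝓝[>] 0) → ∃ (ms : ℕ → ℕ) (g : ℂ → ℂ) (μ : MeasureTheory.Measure ℂ) (c : ℂ), StrictMono ms ∧ (∀ K : Set ℂ, IsCompact K → D.pt 0 ∉ K → μ K < ⊤) ∧ (∀ w : ℂ → ℝ, Continuous w → HasCompactSupport w → D.pt 0 ∉ tsupport w → Filter.Tendsto (fun n => ((fun n => ns (ms n)) n) * ∑ᶠ e ∈ hexDomainBoundary (Λ ((fun n => ns (ms n)) n)), w ((((fun n => ns (ms n)) n : ℝ) : ℂ) * hexMidpoint e) * (‖hexParafermionicObservable (Λ ((fun n => ns (ms n)) n)) (a ((fun n => ns (ms n)) n)) hexCriticalFugacity 0 e‖ / ‖hexParafermionicObservable (Λ ((fun n => ns (ms n)) n)) (a ((fun n => ns (ms n)) n)) hexCriticalFugacity 0 (b ((fun n => ns (ms n)) n))‖)) Filter.atTop (𝓝 (∫ z, w z ∂μ))) ∧ (∀ y ∈ frontier D.carrier ∩ Metric.ball (D.pt 1) ρ, ∃ s : ℝ, 0 < s ∧ ∀ φ : ℂ → ℂ, ContDiff ℝ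 ∞ φ → HasCompactSupport φ → tsupport φ ⊆ Metric.ball y s → ∫ w in D.carrier, g w * Literature.Analysis.Complex.dbarAlong 1 φ w = -(Real.sqrt 3 : ℂ) * Complex.I * ∫ w, φ w ∂μ) ∧ (∀ w ∈ D.carrier, g w = c * Complex.exp ((5 / 8 : ℂ) * (L w - Lb)))) → GateProfileAt D ρ (ρ / 2) Λ a b := by
  intro D ρ Λ m b hAF _hEx a r₀ m₀ _hPR hρd hRM H Φ L Lb hfr Lbar hLbar hLbarL g₀ hg₀ hg₀c hg₀s
  have hρ : 0 < ρ := hAF.1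
  have hflat := hAF.2.1
  have hρ2 : ρ / 2 < ρ := by linarith
  have hpt0 : D.pt 0 ∉ closedBall (D.pt 1) (ρ / 2) := fun h => by
    have := mem_closedBall.1 h
    linarith
  have h3 : (Real.sqrt 3 : ℂ) ≠ 0 := by
    exact_mod_cast (Real.sqrt_pos.2 (by norm_num : (0 : ℝ) < 3)).ne'
  ---------------------------------------------------------------- the line density of the frame
  set E : ℝ → ℂ := fun x => Complex.exp ((5 / 8 : ℂ) *
    (Lbar ((x : ℂ) + ((D.pt 1).im : ℂ) * Complex.I) - Lb)) with hE
  have hEc : ContinuousOn E (Icc ((D.pt 1).re - ρ / 2) ((D.pt 1).re + ρ / 2)) :=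
    continuousOn_gateDensity D Lb hLbar hρ2
  have hLbarp : Lbar (D.pt 1) = Lb :=
    GateProfile.gateExtension_apply_pt_one D hρ hflat hLbar hLbarL hfr.2.2.2.2
  have hE1 : E (D.pt 1).re = 1 := by
    simp only [hE]
    rw [Complex.re_add_im, hLbarp, sub_self, mul_zero, Complex.exp_zero]
  have hLd : DifferentiableOn ℂ L D.carrier :=
    Literature.NumberTheory.Transcendental.ExpDominant.differentiableOn_of_exp_eq D.isOpen hfr.2.2.1
      ((Φ.differentiableOn.analyticOnNhd D.isOpen).deriv).differentiableOn hfr.2.2.2.1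
  ---------------------------------------------------------------- subsequence principle
  refine tendsto_of_subseq_tendsto fun ns hns => ?_
  obtain ⟨ms, g, μ, c, hms, hmf, hside, hgate, hgc⟩ := H Φ L Lb hfr ns hns
  refine ⟨ms, ?_⟩
  beta_reduce at hside
  have hns' : Tendsto (fun n => ns (ms n)) atTop (𝓝[>] 0) := hns.comp hms.tendsto_atTop
  -- side sums for test functions supported in the gate ball
  have hside' : ∀ w : ℂ → ℝ, Continuous w → HasCompactSupport w → tsupport w ⊆ ball (D.pt 1) (ρ / 2) →
      Tendsto (fun n => ns (ms n) * ∑ᶠ e ∈ hexDomainBoundary (Λ (ns (ms n))),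
        w ((ns (ms n) : ℂ) * hexMidpoint e) *
          (‖hexParafermionicObservable (Λ (ns (ms n))) (a (ns (ms n))) hexCriticalFugacity 0 e‖ /
            ‖hexParafermionicObservable (Λ (ns (ms n))) (a (ns (ms n))) hexCriticalFugacity 0
              (b (ns (ms n)))‖)) atTop (𝓝 (∫ z, w z ∂μ)) :=
    fun w hw hwc hws => hside w hw hwc fun h => hpt0 (ball_subset_closedBall (hws h))
  have hfin : μ (closedBall (D.pt 1) (ρ / 2)) < ⊤ := hmf _ (isCompact_closedBall _ _) hpt0
  -- no mass off the gate line
  have hvan : ∀ w : ℂ → ℝ, Continuous w → HasCompactSupport w → tsupport w ⊆ ball (D.pt 1) (ρ / 2) →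
      (∀ z ∈ tsupport w, z.im ≠ (D.pt 1).im) → ∫ z, w z ∂μ = 0 := by
    intro w hw hwc hws hwl
    have hev := GateProfile.eventually_sideSum_eq_zero_of_im_ne hAF a hwc hρ2
      (hws.trans ball_subset_closedBall) hwl
    exact tendsto_nhds_unique (hside' w hw hwc hws)
      (tendsto_const_nhds.congr' ((hns'.eventually hev).mono fun n hn => hn.symm))
  ---------------------------------------------------------------- the candidate `c·exp((5/8)(L̄ − L_b))`
  set gs : ℂ → ℂ := fun z => c * Complex.exp ((5 / 8 : ℂ) * (Lbar z - Lb)) with hgs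
  have hg_gs : EqOn g gs (D.carrier ∩ ball (D.pt 1) ρ) := fun z hz => by
    simp only [hgs]
    rw [hgc z hz.1, hLbarL hz.1]
  have hgsd : DifferentiableOn ℂ gs (D.carrier ∩ ball (D.pt 1) ρ) := by
    have h1 : DifferentiableOn ℂ Lbar D.carrier := hLd.congr hLbarL
    exact ((((h1.sub (differentiableOn_const Lb)).const_mul (5 / 8 : ℂ)).cexp).const_mul c).mono
      inter_subset_left
  have hsubU : {z : ℂ | (D.pt 1).im ≤ z.im} ∩ ball (D.pt 1) ρ ⊆ D.carrier ∪ gateSeg D ρ := by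
    rintro z ⟨hz, hzb⟩
    rcases (show (D.pt 1).im ≤ z.im from hz).lt_or_eq with hlt | heq
    · left
      have : z ∈ {z : ℂ | (D.pt 1).im < z.im} ∩ ball (D.pt 1) ρ := ⟨hlt, hzb⟩
      rw [← hflat] at this
      exact this.1
    · exact Or.inr ⟨heq.symm, hzb⟩
  have hgsc : ContinuousOn gs ({z : ℂ | (D.pt 1).im ≤ z.im} ∩ ball (D.pt 1) ρ) := by
    have h1 : ContinuousOn Lbar ({z : ℂ | (D.pt 1).im ≤ z.im} ∩ ball (D.pt 1) ρ) := hLbar.mono hsubU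
    exact continuousOn_const.mul ((continuousOn_const.mul (h1.sub continuousOn_const)).cexp)
  -- the local gate identity at the gate points of `B(pt 1, ρ)`
  have hθ : (-(Real.sqrt 3 : ℂ) * I) ≠ 0 := mul_ne_zero (neg_ne_zero.2 h3) I_ne_zero
  have hgate' : ∀ y ∈ ball (D.pt 1) ρ, y.im = (D.pt 1).im → ∃ s : ℝ, 0 < s ∧ ∀ φ : ℂ → ℂ,
      ContDiff ℝ ∞ φ → HasCompactSupport φ → tsupport φ ⊆ ball y s →
        ∫ w in D.carrier, g w * dbarAlong 1 φ w = (-(Real.sqrt 3 : ℂ) * I) * ∫ w, φ w ∂μ :=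
    fun y hy hyim => hgate y ⟨GateStability.mem_frontier_of_flat D.isOpen hflat hy hyim, hy⟩
  ---------------------------------------------------------------- (2) `μ = K · E dx` on the gate ball
  set K : ℂ := c / (2 * (Real.sqrt 3 : ℂ)) with hK
  have hident : ∀ φ : ℂ → ℂ, Continuous φ → HasCompactSupport φ →
      tsupport φ ⊆ ball (D.pt 1) (ρ / 2) →
        ∫ z, φ z ∂μ = K * ∫ x in Ioo ((D.pt 1).re - ρ / 2) ((D.pt 1).re + ρ / 2),
          φ ((x : ℂ) + ((D.pt 1).im : ℂ) * I) * E x := by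
    intro φ hφ hφc hφs
    rw [GateProfile.integral_eq_const_mul_lineIntegral D hρ hflat hg_gs hgsd hgsc hfin hvan hθ hgate'
      hφ hφc hφs]
    have h1 : ∫ x in Ioo ((D.pt 1).re - ρ / 2) ((D.pt 1).re + ρ / 2),
        φ ((x : ℂ) + ((D.pt 1).im : ℂ) * I) * gs ((x : ℂ) + ((D.pt 1).im : ℂ) * I) =
        c * ∫ x in Ioo ((D.pt 1).re - ρ / 2) ((D.pt 1).re + ρ / 2),
          φ ((x : ℂ) + ((D.pt 1).im : ℂ) * I) * E x := by
      rw [← integral_const_mul]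
      refine setIntegral_congr_fun measurableSet_Ioo fun x _ => ?_
      simp only [hgs, hE]
      ring
    rw [h1, hK]
    field_simp
  ---------------------------------------------------------------- (3) ratio mixing: `K = 1`
  have hK1 : K = 1 := by
    refine GateProfile.const_eq_one_of_ratioMixing hAF hRM hns' hside' hEc hE1 fun w hw hwc hws => ?_
    have hts : tsupport (fun z => (w z : ℂ)) ⊆ tsupport w :=
      closure_mono (Function.support_comp_subset (g := Complex.ofReal) Complex.ofReal_zero w)
    have h := hident (fun z => (w z : ℂ)) (continuous_ofReal.comp hw)
      (hwc.comp_left Complex.ofReal_zero) (hts.trans hws)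
    beta_reduce at h
    rw [← h]
    exact integral_complex_ofReal.symm
  ---------------------------------------------------------------- (1) the gate functional along `ns ∘ ms`
  have hg₀0 : ∀ z, z ∉ ball (D.pt 1) (ρ / 2) → g₀ z = 0 := fun z hz =>
    image_eq_zero_of_notMem_tsupport fun h => hz (hg₀s h)
  have hre_ts : tsupport (fun z => (g₀ z).re) ⊆ tsupport g₀ :=
    closure_mono (Function.support_comp_subset (g := Complex.re) Complex.zero_re g₀)
  have him_ts : tsupport (fun z => (g₀ z).im) ⊆ tsupport g₀ :=
    closure_mono (Function.support_comp_subset (g := Complex.im) Complex.zero_im g₀)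
  have hre := hside' (fun z => (g₀ z).re) (Complex.continuous_re.comp hg₀)
    (hg₀c.comp_left Complex.zero_re) (hre_ts.trans hg₀s)
  have him := hside' (fun z => (g₀ z).im) (Complex.continuous_im.comp hg₀)
    (hg₀c.comp_left Complex.zero_im) (him_ts.trans hg₀s)
  beta_reduce at hre him
  have h1 := ((continuous_ofReal.tendsto _).comp hre).add
    (((continuous_ofReal.tendsto _).comp him).mul_const I)
  have hlim : Tendsto (fun n => ((ns (ms n) : ℝ) : ℂ) *
      ∑ᶠ e ∈ {e : Sym2 HexVertex | e ∈ hexDomainBoundary (Λ (ns (ms n))) ∧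
          ((ns (ms n) : ℝ) : ℂ) * hexMidpoint e ∈ Metric.ball (D.pt 1) (ρ / 2)},
        g₀ (((ns (ms n) : ℝ) : ℂ) * hexMidpoint e) *
          (hexParafermionicObservable (Λ (ns (ms n))) (a (ns (ms n))) hexCriticalFugacity 0 e /
            hexParafermionicObservable (Λ (ns (ms n))) (a (ns (ms n))) hexCriticalFugacity 0
              (b (ns (ms n))))) atTop
      (𝓝 (((∫ z, (g₀ z).re ∂μ : ℝ) : ℂ) + ((∫ z, (g₀ z).im ∂μ : ℝ) : ℂ) * I)) := by
    refine h1.congr' (Eventually.of_forall fun n => ?_)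
    simp only [Function.comp_apply]
    exact (GateProfile.gateSum_eq_ofReal_add (Λ (ns (ms n))) (a (ns (ms n))) (b (ns (ms n))) (ns (ms n))
      g₀ (ball (D.pt 1) (ρ / 2)) hg₀0).symm
  -- the value of the limit
  have hI : Integrable g₀ μ := GateProfile.integrable_of_eq_zero_off_ball hfin hg₀ hg₀c hg₀0
  have hval : ((∫ z, (g₀ z).re ∂μ : ℝ) : ℂ) + ((∫ z, (g₀ z).im ∂μ : ℝ) : ℂ) * I =
      ∫ x in Ioo ((D.pt 1).re - ρ / 2) ((D.pt 1).re + ρ / 2),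
        g₀ ((x : ℂ) + ((D.pt 1).im : ℂ) * I) * E x := by
    have hr := integral_re hI
    have hi := integral_im hI
    simp only [RCLike.re_to_complex, RCLike.im_to_complex] at hr hi
    rw [hr, hi, Complex.re_add_im, hident g₀ hg₀ hg₀c hg₀s, hK1, one_mul]
  rw [hval] at hlim
  exact hlim

end Summit.CriticalPhenomena.SAWScalingLimit.Theorems.PolygonParitySqueeze

end
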